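import Mathlib
import Summits.Ventures.PercRepro.TriangleCapRegularCellFour

/-!
# PercRepro — THE REGULAR CELL `t = 5 D` ON `6 + (s − t)` VERTICES, EXACTLY: `{bottom, bottom + 4} ∪ [bottom + 6, bottom + 10 D]`
(p3, gen 55; part 306)

At `ℓ = 5` the row excess `Σ_{rows} k (5 − k)` is `0`, `8` or at least `12` (parts 290–291: the first gap `[1, 3]`, the
second gap `{5}` in the units `j − bottom`) and at most `20 D` (`k (5 − k) ≤ 4 k`); conversely the value `4` is the
rows `(4, 1)` and every `6 ≤ m ≤ 10 D` is realised by BLOCKS of five edges — `(2,3)` (`6`), `(3,1,1)` (`7`),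
`(2,2,1)` (`8`), `(2,1,1,1)` (`9`), `(1,1,1,1,1)` (`10`) — and of ten edges for `11 ≤ e ≤ 15`, with
`m = 10 a + e`, `a = ⌊(m − 6)/10⌋`, `e ∈ [6, 15]` (`rows_of_excess_five`).  THEOREM (`regular_cell_five`, `5 ≤ D`,
`t = 5 D`, `2 t ≤ s`): `j` is the band value of a triangle-free graph on `6 + (s − t)` vertices with `s` edges, a vertex
of degree `s − t` and every off-degree `≤ D` IFF `j = bottomReg 5 D`, `j = bottomReg 5 D + 4`, or
`bottomReg 5 D + 6 ≤ j ≤ bottomReg 5 D + 10 D` (`bottomReg 5 D = 10 D (D − 1)`) — the g54 successor item (2) at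
`ℓ = 5`: the excess set misses exactly `{1, 2, 3, 5}`.  Axioms: standard.
-/

namespace PercRepro

namespace TriangleCap

namespace C047

open Finset

/-- The entries of a list in `[1, 5]` give a sequence in `[1, 5]` below the length. -/
theorem getD_bounds_five (L : List ℕ) (hL : ∀ x ∈ L, 1 ≤ x ∧ x ≤ 5) (i : ℕ) (hi : i < L.length) :
    1 ≤ L.getD i 0 ∧ L.getD i 0 ≤ 5 := by
  rw [List.getD_eq_getElem L 0 hi]
  exact hL _ (List.getElem_mem hi)

/-- The block of excess `e ∈ [6, 15]` (one or two rows-groups of five edges each): its sizes. -/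
def blockFive (e : ℕ) : List ℕ :=
  if e = 6 then [2, 3] else if e = 7 then [3, 1, 1] else if e = 8 then [2, 2, 1] else if e = 9 then [2, 1, 1, 1]
  else if e = 10 then [1, 1, 1, 1, 1] else if e = 11 then [3, 1, 1, 4, 1] else if e = 12 then [2, 3, 2, 3]
  else if e = 13 then [2, 3, 3, 1, 1] else if e = 14 then [2, 3, 2, 2, 1] else [2, 3, 2, 1, 1, 1]

/-- The facts about a block: its entries lie in `[1, 5]`, its sum is `5` or `10` (`5` for `e ≤ 10`), and its excess
`Σ k (5 − k)` is `2 e`. -/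
theorem blockFive_facts (e : ℕ) (he1 : 6 ≤ e) (he2 : e ≤ 15) :
    (∀ x ∈ blockFive e, 1 ≤ x ∧ x ≤ 5) ∧ ((blockFive e).sum = 5 ∨ (blockFive e).sum = 10) ∧
      (e ≤ 10 → (blockFive e).sum = 5) ∧ ((blockFive e).map (fun k => k * (5 - k))).sum = 2 * e := by
  unfold blockFive
  interval_cases e <;> simp

/-- **THE ROWS OF EVERY EXCESS AT `ℓ = 5`:** for `m = 4` or `6 ≤ m ≤ 10 D` there are row sizes `1 ≤ k i ≤ 5`,
`i < N`, with `Σ k = 5 D` and `Σ k (5 − k) = 2 m`. -/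
theorem rows_of_excess_five (D m : ℕ) (hD : 1 ≤ D) (hm : m = 4 ∨ (6 ≤ m ∧ m ≤ 10 * D)) :
    ∃ (N : ℕ) (k : ℕ → ℕ), (∀ i, i < N → 1 ≤ k i ∧ k i ≤ 5) ∧ ∑ i ∈ range N, k i = 5 * D ∧
      ∑ i ∈ range N, k i * (5 - k i) = 2 * m := by
  rcases hm with rfl | ⟨hm1, hm2⟩
  · -- the rows `(4, 1)` and `D − 1` full rows
    set L := [4, 1] ++ List.replicate (D - 1) 5 with hL
    have hLmem : ∀ x ∈ L, 1 ≤ x ∧ x ≤ 5 := by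
      intro x hx
      rw [hL, List.mem_append, List.mem_replicate] at hx
      rcases hx with hx | hx
      · simp only [List.mem_cons, List.not_mem_nil, or_false] at hx
        omega
      · omega
    refine ⟨L.length, fun i => L.getD i 0, fun i hi => getD_bounds_five L hLmem i hi, ?_, ?_⟩
    · rw [sum_range_getD L (fun x => x), hL, List.map_append, List.sum_append, List.map_id', List.map_id',
        List.sum_replicate]
      simp only [smul_eq_mul, List.sum_cons, List.sum_nil]
      omega
    · rw [sum_range_getD L (fun k => k * (5 - k)), hL, List.map_append, List.sum_append, List.map_replicate,
        List.sum_replicate]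
      simp
  · set a := (m - 6) / 10 with ha
    set e := m - 10 * a with he
    have he1 : 6 ≤ e := by omega
    have he2 : e ≤ 15 := by omega
    have haD : a + 1 ≤ D := by omega
    have haD2 : 11 ≤ e → a + 2 ≤ D := by omega
    obtain ⟨hb1, hb2, hb3, hb5⟩ := blockFive_facts e he1 he2
    set B := blockFive e with hB
    set c := B.sum / 5 with hc
    have hc' : B.sum = 5 * c := by
      rcases hb2 with h | h <;> rw [h] at hc ⊢ <;> omega
    have hcD : a + c ≤ D := by
      rcases hb2 with h | h
      · rw [h] at hc
        omega
      · rw [h] at hc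
        have : 11 ≤ e := by
          by_contra hcon
          have := hb3 (by omega)
          omega
        have := haD2 this
        omega
    set L := List.replicate (5 * a) 1 ++ B ++ List.replicate (D - a - c) 5 with hL
    have hLmem : ∀ x ∈ L, 1 ≤ x ∧ x ≤ 5 := by
      intro x hx
      rw [hL, List.mem_append, List.mem_append, List.mem_replicate, List.mem_replicate] at hx
      rcases hx with (hx | hx) | hx
      · omega
      · exact hb1 x hx
      · omega
    refine ⟨L.length, fun i => L.getD i 0, fun i hi => getD_bounds_five L hLmem i hi, ?_, ?_⟩
    · rw [sum_range_getD L (fun x => x), hL, List.map_append, List.map_append, List.sum_append, List.sum_append,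
        List.map_id', List.map_id', List.map_id', List.sum_replicate, List.sum_replicate, hc']
      simp only [smul_eq_mul]
      omega
    · rw [sum_range_getD L (fun k => k * (5 - k)), hL, List.map_append, List.map_append, List.sum_append,
        List.sum_append, List.map_replicate, List.map_replicate, List.sum_replicate, List.sum_replicate, hb5]
      simp only [smul_eq_mul]
      omega

/-- The excess of a row is at most four times its size: `k (5 − k) ≤ 4 k`. -/
theorem excess_le_four_mul (k : ℕ) : k * (5 - k) ≤ 4 * k := by
  rcases Nat.lt_or_ge k 5 with h | h
  · interval_cases k <;> omega
  · rw [Nat.sub_eq_zero_of_le h, mul_zero]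
    exact Nat.zero_le _

/-- **THE REGULAR CELL `t = 5 D`, EXACTLY:** for `5 ≤ D`, `t = 5 D`, `2 t ≤ s`, `j` is the band value of a
triangle-free graph on `6 + (s − t)` vertices with `s` edges, a vertex of degree `s − t` and every off-degree
`≤ D` IFF `j = bottomReg 5 D`, `j = bottomReg 5 D + 4`, or `bottomReg 5 D + 6 ≤ j ≤ bottomReg 5 D + 10 D`. -/
theorem regular_cell_five (s t D j : ℕ) (hD : 5 ≤ D) (ht : t = 5 * D) (hs : 2 * t ≤ s) :
    (∃ (H : SimpleGraph (Fin (5 + 1 + (s - t)))) (_ : DecidableRel H.Adj), H.CliqueFree 3 ∧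
      H.edgeFinset.card = s ∧ ∃ w, deg H w + t = s ∧ (∀ v, offDeg H w v ≤ D) ∧
        ∑ v, deg H v * deg H v + 2 * (t * (s - t - 1)) + 2 * j = s * (s + 1)) ↔
    (j = bottomReg 5 D ∨ j = bottomReg 5 D + 4 ∨ (bottomReg 5 D + 6 ≤ j ∧ j ≤ bottomReg 5 D + 10 * D)) := by
  subst ht
  have hb := two_mul_bottomReg 5 D (by norm_num) hD
  constructor
  · intro hj
    obtain ⟨N, k, hk, hsum, hid⟩ := (regular_cell_iff s (5 * D) 5 D j (by norm_num) hD rfl hs).mp hj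
    have hup : ∑ i ∈ range N, k i * (5 - k i) ≤ 20 * D := by
      calc ∑ i ∈ range N, k i * (5 - k i) ≤ ∑ i ∈ range N, 4 * k i := sum_le_sum (fun i _ => excess_le_four_mul (k i))
        _ = 4 * ∑ i ∈ range N, k i := by rw [mul_sum]
        _ = 20 * D := by rw [hsum]; ring
    rcases row_excess_trichotomy 5 D k N (by norm_num) (fun m hm => (hk m hm).1) (fun m hm => (hk m hm).2) hsum
      with h0 | h1 | h2
    · left
      omega
    · right
      left
      omega
    · right
      right
      omega
  · rintro (rfl | rfl | ⟨hlo, hhi⟩)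
    · exact ((regular_cell_first_gap s (5 * D) 5 D (by norm_num) hD rfl hs).2.1)
    · apply (regular_cell_iff s (5 * D) 5 D _ (by norm_num) hD rfl hs).mpr
      obtain ⟨N, k, hk, hsum, hex⟩ := rows_of_excess_five D 4 (by omega) (Or.inl rfl)
      refine ⟨N, k, hk, hsum, ?_⟩
      rw [hex]
      omega
    · apply (regular_cell_iff s (5 * D) 5 D j (by norm_num) hD rfl hs).mpr
      obtain ⟨N, k, hk, hsum, hex⟩ := rows_of_excess_five D (j - bottomReg 5 D) (by omega) (Or.inr ⟨by omega, by omega⟩)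
      refine ⟨N, k, hk, hsum, ?_⟩
      rw [hex]
      omega

end C047

end TriangleCap

end PercRepro
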